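import Summits.QuantumFields.YangMills.Theorems.BalabanUVNodesN15KingModelTheorem21TwoPoint
import Summits.QuantumFields.YangMills.Theorems.BalabanUVNodesN15KingModelLatticeRiemannSums

/-!
# BalabanUVNodes ∕ N15 — THE KING-MODEL RUNG (PART Ϝ-j): THE THERMODYNAMIC LIMIT OF THE CONTINUUM BLOCK-SMEARED TWO-POINT FUNCTION —
# `S₂^{(∞)}_Ω(z) → S₂^{ℝ}(z) = (2π)^{−(d+1)} ∫_{ℝ^{d+1}} |u⁰(p)|² cos(p·z) ∕ (|p|² + m²) dp` AS ALL PERIODS `M_ν → ∞` (infinite volume AFTER the continuum limit)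
# (Track A, DAG node N15 = NE2; FAN-OUT v1.1 §N15 s3 «KING-MODEL RUNG … NE2's analogue DECIDED in the model»)

HONEST FRAMING.  Count-neutral (cell `pub-ymgap`, seat `pub-ymgap-dag-n15-e` g33; `--supports stmt-QuantumFields-27366 --as helper` = K3⁸
`SpineGivenEndpointR13SepCoPHV`).  TEMPLATE LITERATURE: C. King, *The U(1) Higgs model. I. The continuum limit*, Commun. Math. Phys. **102** (1986) 649–677
[King1986] — KING's OWN `A = 0`, `g = 0` MODEL.  Theorem 2.1 is a FINITE-VOLUME statement whose constants are uniform in `|T|` ((2.23)); this file takes, for the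
free model's block-smeared two-point function `S₂^{(∞)}` of part Ϝ-d (the `K → ∞` limit on the unit torus `Ω = Π ℤ∕M_ν`), the subsequent limit `|Ω| → ∞`.  The
infinite-volume limit of the INTERACTING model is [King1986II]'s subject and is NOT touched.  NOT Bałaban's objects; NOT a node discharge (N15 is booked through n15-a's
knit, untouched here); nothing continuum-Yang–Mills ∕ ℝ⁴ ∕ OS ∕ mass-gap ∕ Clay.  0 `sorry`; standard axioms; FIVE definitions (`aliasUnfoldIdx`, `aliasFoldIdx`, `aliasUnfoldEquiv`,
`twoPtIntegrand`, `kingS2Inf` — plumbing ∕ the limit object).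

THE MATHEMATICS.  `S₂^{(∞)}_Ω(z) = |Ω|⁻¹Σ_{q∈Ω̂} S_∞(p′(q))cos(p′(q)·z)` with `S_∞(p′) = Σ_{j∈ℤ^{d+1}} g(p′ + 2πj)`, `g(p) = |u⁰(p)|²∕(|p|² + m²)` (parts Ϡ-b, Ϝ-d; `Re e^{iq·z} =
cos(p′(q)·z)`).  Since `cos((p′ + 2πj)·z) = cos(p′·z)` for `z ∈ ℤ^{d+1}`, and `(q, j) ↦ k = v(q) + Mj` (`v` = centred representative) is a bijection `Ω̂ × ℤ^{d+1} ≃ ℤ^{d+1}`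
with `p′(q) + 2πj = 2πk∕M` (coordinatewise), UNFOLDING the alias series turns the finite-volume kernel into a LATTICE RIEMANN SUM over all of momentum space:
`S₂^{(∞)}_Ω(z) = (2π)^{−(d+1)} Σ_{k∈ℤ^{d+1}} (Π_ν 2π∕M_ν)·h_z(2πk∕M)`, `h_z(p) = g(p)cos(p·z)`.  `h_z` is continuous (`|u⁰(p)|² = Π_ν sinc²(p_ν∕2)`) with the product
envelope `|h_z(p)| ≤ m⁻²Π_ν sinc²(p_ν∕2)`, `sinc²(s∕2) ≤ min(1, 4∕s²) ≤ (17 + 16π²)(1 + t²)⁻¹` for `|s − t| ≤ 2π` (window majorant, integrable); part Ϝ-i's dominated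
convergence of lattice sums gives, as all `M_ν → ∞` (meshes `2π∕M_ν → 0`): `S₂^{(∞)}_Ω(z) → S₂^{ℝ}(z) := (2π)^{−(d+1)}∫_{ℝ^{d+1}} g(p)cos(p·z)dp` — the block-smeared
two-point function of the free massive field on `ℝ^{d+1}`, in King's momentum representation.  (`|S₂^{ℝ}(z)| ≤ m⁻²` passes from part Ϝ-d's volume-free bound.)

WHAT THIS FILE PROVES (kernel).  §1 `aliasUnfoldIdx`∕`aliasFoldIdx`∕`aliasUnfoldEquiv` (`Ω̂ × ℤ^{d+1} ≃ ℤ^{d+1}`), `cornerPt_aliasUnfoldIdx` (`2πk∕M = p′(q) + 2πj`).  §2 ★ `re_chi_intCast` (`Re e^{iq·z} =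
cos(p′(q)·z)`), `cos_aliasPt_dot`.  §3 `twoPtIntegrand`, `aliasTerm0_mul_cos_eq`, ★ `norm_sq_uFac0_eq_sinc_sq` (`|f₀(x)|² = sinc²(x∕2)`), `continuous_norm_sq_uWeight0`, `continuous_twoPtIntegrand`,
`sinc_sq_half_le_one`, `sinc_sq_half_le_four_div_sq`, ★ `sinc_sq_half_window` (the window majorant), `abs_twoPtIntegrand_le`.  §4 `summable_unfolded`, ★★★ **`kingS2Lim_eq_latticeSum`**
(the unfolding identity).  §5 `kingS2Inf` (the limit object), ★★★ **`tendsto_kingS2Lim_volume`** (the thermodynamic limit along ANY sequence of tori with all periods `→ ∞`),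
★★ `abs_kingS2Inf_le` (`|S₂^{ℝ}(z)| ≤ m⁻²`).  §6 `intCast_zmod_eq_zero_iff_of_abs_lt`, `eventually_zmod_eq_zero_iff`, ★★ **`tendsto_blockCovLim_volume`** (NE2's continuum unit kernel `C^{(∞)}`:
`→ S₂^{ℝ}(z) + a_∞⁻¹[z = 0]`).

HONEST SCOPE.  Free field; unit-block smearing; the order of limits is `K → ∞` first (part Ϝ-d), then `|Ω| → ∞`; no rate in the volume is claimed.  N15 untouched; counts
unmoved.  Locators: [King1986] Thm 2.1 (2.22)–(2.23) p.654, (2.14) p.653, (4.5) p.670, (4.35) p.674.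
-/

noncomputable section

open scoped BigOperators ComplexConjugate
open Finset Matrix Filter Topology Complex MeasureTheory

namespace Summit.QuantumFields.YangMills.BalabanUVNodes.N15KingModelRung

open Literature.MathematicalPhysics.QuantumFieldTheory.Balaban1983to89.B5Prop11Plancherel (Tor fine chi sOf abs_sOf_le)
open Literature.MathematicalPhysics.QuantumFieldTheory.King1986 (momSq aliasPt)
open Literature.MathematicalPhysics.QuantumFieldTheory.King1986.Torus
open LatticeRiemann

variable {n : ℕ}

/-! ## §1 Unfolding the alias fibres: `Ω̂ × ℤ^n ≃ ℤ^n` -/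

section Unfold

variable (M : Fin n → ℕ) [hM : ∀ ν, NeZero (M ν)]

/-- `(q, j) ↦ k = v(q) + M·j` coordinatewise (`v` the centred representative). [cite: King1986, (4.2) p.670] -/
def aliasUnfoldIdx (p : Tor M × (Fin n → ℤ)) : Fin n → ℤ := fun ν => ((p.1 ν).valMinAbs : ℤ) + (M ν : ℤ) * p.2 ν

/-- `k ↦ (k mod M, (k − v(k mod M))∕M)`. [cite: King1986, (4.2) p.670] -/
def aliasFoldIdx (k : Fin n → ℤ) : Tor M × (Fin n → ℤ) :=
  (fun ν => ((k ν : ℤ) : ZMod (M ν)), fun ν => (k ν - (((k ν : ℤ) : ZMod (M ν)).valMinAbs : ℤ)) / (M ν : ℤ))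

/-- `fold ∘ unfold = id`. [folklore] -/
theorem aliasFold_unfold (p : Tor M × (Fin n → ℤ)) : aliasFoldIdx M (aliasUnfoldIdx M p) = p := by
  obtain ⟨q, j⟩ := p
  have hM0 : ∀ ν, (M ν : ℤ) ≠ 0 := fun ν => by exact_mod_cast NeZero.ne (M ν)
  have hcast : ∀ ν, (((((q ν).valMinAbs : ℤ) + (M ν : ℤ) * j ν : ℤ)) : ZMod (M ν)) = q ν := fun ν => by
    rw [Int.cast_add, Int.cast_mul, ZMod.coe_valMinAbs, Int.cast_natCast, ZMod.natCast_self, zero_mul, add_zero]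
  unfold aliasFoldIdx aliasUnfoldIdx
  simp only [Prod.mk.injEq]
  exact ⟨funext fun ν => hcast ν, funext fun ν => by rw [hcast ν, add_sub_cancel_left, Int.mul_ediv_cancel_left _ (hM0 ν)]⟩

omit hM in
/-- `unfold ∘ fold = id`. [folklore] -/
theorem aliasUnfold_fold (k : Fin n → ℤ) : aliasUnfoldIdx M (aliasFoldIdx M k) = k := by
  unfold aliasFoldIdx aliasUnfoldIdx
  funext ν
  have hdvd : (M ν : ℤ) ∣ k ν - (((k ν : ℤ) : ZMod (M ν)).valMinAbs : ℤ) := by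
    rw [← ZMod.intCast_eq_intCast_iff_dvd_sub, ZMod.coe_valMinAbs]
  simp only
  rw [Int.mul_ediv_cancel' hdvd]
  abel

/-- ★ The unfolding bijection `Ω̂ × ℤ^n ≃ ℤ^n`. [cite: King1986, (4.2) p.670] -/
def aliasUnfoldEquiv : Tor M × (Fin n → ℤ) ≃ (Fin n → ℤ) where
  toFun := aliasUnfoldIdx M
  invFun := aliasFoldIdx M
  left_inv := aliasFold_unfold M
  right_inv := aliasUnfold_fold M

/-- `2πk∕M = p′(q) + 2πj` for `k = unfold(q, j)`: the unfolded lattice point is the alias point. [cite: King1986, (4.2) p.670, (4.5) p.670] -/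
theorem cornerPt_aliasUnfoldIdx (q : Tor M) (j : Fin n → ℤ) :
    cornerPt (fun ν => 2 * Real.pi / (M ν : ℝ)) (aliasUnfoldIdx M (q, j)) = aliasPt (sOf M q) j := by
  funext ν
  have hMν : (M ν : ℝ) ≠ 0 := by exact_mod_cast NeZero.ne (M ν)
  simp only [cornerPt, aliasUnfoldIdx, aliasPt, sOf]
  push_cast
  field_simp

end Unfold

/-! ## §2 Characters at integer sites are cosines of `p′(q)·z` -/

section Characters

variable (M : Fin n → ℕ) [hM : ∀ ν, NeZero (M ν)]

/-- ★ `Re e^{iq·z} = cos(Σ_ν p′(q)_ν z_ν)` for an integer site vector `z` (read modulo `M`). [cite: King1986, (4.35) p.674] -/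
theorem re_chi_intCast (q : Tor M) (z : Fin n → ℤ) :
    (chi M q (fun ν => ((z ν : ℤ) : ZMod (M ν)))).re = Real.cos (∑ ν, sOf M q ν * z ν) := by
  have h : chi M q (fun ν => ((z ν : ℤ) : ZMod (M ν))) = Complex.exp ((∑ ν, sOf M q ν * z ν : ℝ) * I) := by
    unfold chi
    rw [Complex.ofReal_sum, Finset.sum_mul, Complex.exp_sum]
    refine Finset.prod_congr rfl fun ν _ => ?_
    have hq : q ν * ((z ν : ℤ) : ZMod (M ν)) = ((((q ν).valMinAbs * z ν : ℤ)) : ZMod (M ν)) := by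
      rw [Int.cast_mul, ZMod.coe_valMinAbs]
    rw [hq, ZMod.stdAddChar_coe]
    congr 1
    simp only [sOf]
    push_cast
    have hMν : (M ν : ℂ) ≠ 0 := by exact_mod_cast NeZero.ne (M ν)
    field_simp
  rw [h, Complex.exp_ofReal_mul_I_re]

omit hM in
/-- `cos((p′ + 2πj)·z) = cos(p′·z)` for integer `j, z`. [folklore] -/
theorem cos_aliasPt_dot (p : Fin n → ℝ) (j z : Fin n → ℤ) :
    Real.cos (∑ ν, aliasPt p j ν * z ν) = Real.cos (∑ ν, p ν * z ν) := by
  have h : ∑ ν, aliasPt p j ν * z ν = ∑ ν, p ν * z ν + ((∑ ν, j ν * z ν : ℤ) : ℝ) * (2 * Real.pi) := by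
    push_cast
    rw [Finset.sum_mul, ← Finset.sum_add_distrib]
    exact Finset.sum_congr rfl fun ν _ => by simp only [aliasPt]; ring
  rw [h, Real.cos_add_int_mul_two_pi]

end Characters

/-! ## §3 The integrand `h_z(p) = |u⁰(p)|² cos(p·z) ∕ (|p|² + m²)`, its continuity and its product envelope -/

section Integrand

/-- The momentum-space integrand of the infinite-volume two-point function at separation `z ∈ ℤ^n`: `g(p)cos(p·z)`, `g(p) = |u⁰(p)|²∕(|p|² + m²)`.
[cite: King1986, (4.5) p.670, Thm 2.1 (2.22) p.654] -/
def twoPtIntegrand (m2 : ℝ) (z : Fin n → ℤ) (p : Fin n → ℝ) : ℝ := ‖uWeight0 p‖ ^ 2 / (momSq p + m2) * Real.cos (∑ ν, p ν * z ν)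

/-- The alias term times the cosine IS the integrand at the alias point. [cite: King1986, (4.5) p.670] -/
theorem aliasTerm0_mul_cos_eq (m2 : ℝ) (p : Fin n → ℝ) (j z : Fin n → ℤ) :
    aliasTerm0 m2 p j * Real.cos (∑ ν, p ν * z ν) = twoPtIntegrand m2 z (aliasPt p j) := by
  rw [twoPtIntegrand, cos_aliasPt_dot, aliasTerm0]

/-- ★ `|f₀(x)|² = sinc²(x∕2)` (`f₀(x) = (e^{−ix} − 1)∕(−ix)`, `f₀(0) = 1`). [cite: King1986, (4.3) p.670] -/
theorem norm_sq_uFac0_eq_sinc_sq (x : ℝ) : ‖uFac0 x‖ ^ 2 = Real.sinc (x / 2) ^ 2 := by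
  by_cases hx : x = 0
  · subst hx; simp [uFac0, Real.sinc_zero]
  · have hx2 : x / 2 ≠ 0 := div_ne_zero hx two_ne_zero
    rw [uFac0, if_neg hx, norm_div, norm_fdq0, Real.sinc_of_ne_zero hx2]
    have h1 : ‖Complex.exp (I * ((-x : ℝ) : ℂ)) - 1‖ = |2 * Real.sin (x / 2)| := by
      rw [Complex.norm_exp_I_mul_ofReal_sub_one, Real.norm_eq_abs, show (-x) / 2 = -(x / 2) by ring, Real.sin_neg, mul_neg, abs_neg]
    rw [h1, div_pow, div_pow, sq_abs, sq_abs]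
    field_simp

/-- `p ↦ |u⁰(p)|²` is continuous (a product of `sinc²`). [cite: King1986, (4.3) p.670] -/
theorem continuous_norm_sq_uWeight0 : Continuous fun p : Fin n → ℝ => ‖uWeight0 p‖ ^ 2 := by
  have h : (fun p : Fin n → ℝ => ‖uWeight0 p‖ ^ 2) = fun p => ∏ μ, Real.sinc (p μ / 2) ^ 2 := by
    funext p
    rw [norm_uWeight0, ← Finset.prod_pow]
    exact Finset.prod_congr rfl fun μ _ => norm_sq_uFac0_eq_sinc_sq (p μ)
  rw [h]
  exact continuous_finsetProd _ fun μ _ => ((Real.continuous_sinc.comp ((continuous_apply μ).div_const 2)).pow 2)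

/-- `h_z` is continuous (`m² > 0`). [cite: King1986, (4.5) p.670] -/
theorem continuous_twoPtIntegrand {m2 : ℝ} (hm : 0 < m2) (z : Fin n → ℤ) : Continuous (twoPtIntegrand m2 z) := by
  unfold twoPtIntegrand
  refine Continuous.mul (continuous_norm_sq_uWeight0.div ?_ fun p => ?_) ?_
  · exact (continuous_finsetSum _ fun μ _ => (continuous_apply μ).pow 2).add continuous_const
  · have : 0 ≤ momSq p := Finset.sum_nonneg fun μ _ => sq_nonneg _
    exact ne_of_gt (by unfold momSq at this ⊢; linarith)
  · exact Real.continuous_cos.comp (continuous_finsetSum _ fun ν _ => (continuous_apply ν).mul continuous_const)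

/-- `sinc²(s∕2) ≤ 1`. [folklore] -/
theorem sinc_sq_half_le_one (s : ℝ) : Real.sinc (s / 2) ^ 2 ≤ 1 := by
  have h := Real.abs_sinc_le_one (s / 2)
  rw [← sq_abs]
  nlinarith [abs_nonneg (Real.sinc (s / 2))]

/-- `sinc²(s∕2) ≤ 4∕s²` (`s ≠ 0`). [folklore] -/
theorem sinc_sq_half_le_four_div_sq {s : ℝ} (hs : s ≠ 0) : Real.sinc (s / 2) ^ 2 ≤ 4 / s ^ 2 := by
  have hs2 : s / 2 ≠ 0 := div_ne_zero hs two_ne_zero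
  rw [Real.sinc_of_ne_zero hs2, div_pow]
  have h1 : Real.sin (s / 2) ^ 2 ≤ 1 := Real.sin_sq_le_one _
  have h2 : 0 < (s / 2) ^ 2 := by positivity
  rw [div_le_div_iff₀ h2 (by positivity)]
  nlinarith

/-- ★ THE WINDOW MAJORANT: `sinc²(s∕2) ≤ (17 + 16π²)·(1 + t²)⁻¹` whenever `|s − t| ≤ 2π`. [folklore] -/
theorem sinc_sq_half_window {s t : ℝ} (hst : |s - t| ≤ 2 * Real.pi) : Real.sinc (s / 2) ^ 2 ≤ (17 + 16 * Real.pi ^ 2) * (1 + t ^ 2)⁻¹ := by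
  have hπ := Real.pi_pos
  have h1t : 0 < 1 + t ^ 2 := by positivity
  rw [← div_eq_mul_inv, le_div_iff₀ h1t]
  by_cases ht : |t| ≤ 4 * Real.pi
  · have hs1 := sinc_sq_half_le_one s
    have ht2 : t ^ 2 ≤ 16 * Real.pi ^ 2 := by rw [← sq_abs]; nlinarith [abs_nonneg t]
    nlinarith
  · push Not at ht
    have hπ3 := Real.pi_gt_three
    have hs0 : |t| / 2 ≤ |s| := by
      have := abs_sub_abs_le_abs_sub t s; rw [abs_sub_comm] at this; linarith
    have ht0 : t ≠ 0 := by intro h; rw [h, abs_zero] at ht; linarith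
    have htpos : 0 < t ^ 2 := by positivity
    have hspos : 0 < |s| := lt_of_lt_of_le (by positivity) hs0
    have hs : s ≠ 0 := abs_pos.mp hspos
    have h4 := sinc_sq_half_le_four_div_sq hs
    have hs2 : t ^ 2 / 4 ≤ s ^ 2 := by
      have h1 : (|t| / 2) ^ 2 ≤ |s| ^ 2 := by gcongr
      rw [div_pow, sq_abs, sq_abs] at h1; linarith
    have hspos2 : 0 < s ^ 2 := by positivity
    have h16 : 4 / s ^ 2 ≤ 16 / t ^ 2 := by rw [div_le_div_iff₀ hspos2 htpos]; linarith
    have ht2 : 16 * Real.pi ^ 2 < t ^ 2 := by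
      have h1 : (4 * Real.pi) ^ 2 < |t| ^ 2 := by gcongr
      rw [sq_abs] at h1; linarith
    calc Real.sinc (s / 2) ^ 2 * (1 + t ^ 2) ≤ 16 / t ^ 2 * (1 + t ^ 2) := by
          exact mul_le_mul_of_nonneg_right (h4.trans h16) h1t.le
      _ = 16 / t ^ 2 + 16 := by field_simp
      _ ≤ 17 + 16 * Real.pi ^ 2 := by
          have : 16 / t ^ 2 ≤ 1 := by rw [div_le_one htpos]; nlinarith
          nlinarith

/-- The product envelope: `|h_z(y)| ≤ m⁻²·Π_ν sinc²(y_ν∕2)`. [cite: King1986, (4.5) p.670] -/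
theorem abs_twoPtIntegrand_le {m2 : ℝ} (hm : 0 < m2) (z : Fin n → ℤ) (y : Fin n → ℝ) :
    |twoPtIntegrand m2 z y| ≤ m2⁻¹ * ∏ ν, Real.sinc (y ν / 2) ^ 2 := by
  have hmom : 0 ≤ momSq y := Finset.sum_nonneg fun μ _ => sq_nonneg _
  have hden : m2 ≤ momSq y + m2 := by linarith
  have hw : ‖uWeight0 y‖ ^ 2 = ∏ ν, Real.sinc (y ν / 2) ^ 2 := by
    rw [norm_uWeight0, ← Finset.prod_pow]
    exact Finset.prod_congr rfl fun μ _ => norm_sq_uFac0_eq_sinc_sq (y μ)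
  have hw0 : 0 ≤ ∏ ν, Real.sinc (y ν / 2) ^ 2 := Finset.prod_nonneg fun ν _ => sq_nonneg _
  unfold twoPtIntegrand
  rw [abs_mul, hw, abs_div, abs_of_nonneg hw0, abs_of_pos (by linarith)]
  calc (∏ ν, Real.sinc (y ν / 2) ^ 2) / (momSq y + m2) * |Real.cos (∑ ν, y ν * z ν)|
      ≤ (∏ ν, Real.sinc (y ν / 2) ^ 2) / m2 * 1 := by
        gcongr
        exact Real.abs_cos_le_one _
    _ = m2⁻¹ * ∏ ν, Real.sinc (y ν / 2) ^ 2 := by rw [mul_one, div_eq_inv_mul]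

end Integrand

/-! ## §4 The unfolding identity: the finite-volume kernel is a lattice Riemann sum over all of momentum space -/

section Unfolding

variable {d : ℕ} (M : Fin (d + 1) → ℕ) [hM : ∀ ν, NeZero (M ν)]

/-- The unfolded family `(q, j) ↦ aliasTerm0(p′(q))_j · cos(p′(q)·z)` is absolutely summable on `Ω̂ × ℤ^n`. [cite: King1986, (4.20)–(4.22) p.672] -/
theorem summable_unfolded {m2 : ℝ} (hm : 0 < m2) (z : Fin (d + 1) → ℤ) :
    Summable fun p : Tor M × (Fin (d + 1) → ℤ) => aliasTerm0 m2 (sOf M p.1) p.2 * Real.cos (∑ ν, sOf M p.1 ν * z ν) := by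
  refine Summable.of_abs ?_
  refine (summable_prod_of_nonneg fun p => abs_nonneg _).mpr ⟨fun q => ?_, Summable.of_finite⟩
  refine Summable.of_nonneg_of_le (fun j => abs_nonneg _) (fun j => ?_) (summable_aliasTerm0 hm (abs_sOf_le M q))
  rw [abs_mul, abs_of_nonneg (aliasTerm0_nonneg hm.le _ _)]
  exact mul_le_of_le_one_right (aliasTerm0_nonneg hm.le _ _) (Real.abs_cos_le_one _)

/-- ★★★ **THE UNFOLDING IDENTITY**: `S₂^{(∞)}_Ω(0, z) = (2π)^{−n}·Σ_{k∈ℤ^n} (Π_ν 2π∕M_ν)·h_z(2πk∕M)` — the finite-volume continuum kernel is a lattice Riemann sum of `h_z`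
over all of momentum space with mesh `2π∕M_ν`. [cite: King1986, (4.5) p.670, (4.35) p.674, Thm 2.1 (2.22) p.654] -/
theorem kingS2Lim_eq_latticeSum {m2 : ℝ} (hm : 0 < m2) (z : Fin (d + 1) → ℤ) :
    kingS2Lim M m2 0 (fun ν => ((z ν : ℤ) : ZMod (M ν)))
      = ((2 * Real.pi) ^ (d + 1))⁻¹ * ∑' k : Fin (d + 1) → ℤ, (∏ ν, 2 * Real.pi / (M ν : ℝ)) * twoPtIntegrand m2 z (cornerPt (fun ν => 2 * Real.pi / (M ν : ℝ)) k) := by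
  have hπ : (2 * Real.pi) ^ (d + 1) ≠ 0 := pow_ne_zero _ (mul_ne_zero two_ne_zero Real.pi_ne_zero)
  have hMr : ∀ ν, (M ν : ℝ) ≠ 0 := fun ν => by exact_mod_cast NeZero.ne (M ν)
  -- the kernel as a finite sum of alias series times cosines
  have hker : kingS2Lim M m2 0 (fun ν => ((z ν : ℤ) : ZMod (M ν)))
      = (Fintype.card (Tor M) : ℝ)⁻¹ * ∑ q : Tor M, ∑' j : Fin (d + 1) → ℤ, aliasTerm0 m2 (sOf M q) j * Real.cos (∑ ν, sOf M q ν * z ν) := by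
    unfold kingS2Lim
    congr 1
    refine Finset.sum_congr rfl fun q _ => ?_
    rw [sub_zero, re_chi_intCast, aliasSeries0, tsum_mul_right]
  -- interchange: finite sum of series = series over the product = series over `ℤ^n` (unfolding)
  have hsum := summable_unfolded M hm z
  have hprod : ∑ q : Tor M, ∑' j : Fin (d + 1) → ℤ, aliasTerm0 m2 (sOf M q) j * Real.cos (∑ ν, sOf M q ν * z ν)
      = ∑' p : Tor M × (Fin (d + 1) → ℤ), aliasTerm0 m2 (sOf M p.1) p.2 * Real.cos (∑ ν, sOf M p.1 ν * z ν) := by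
    rw [Summable.tsum_prod hsum, tsum_fintype]
  have hunf : ∑' p : Tor M × (Fin (d + 1) → ℤ), aliasTerm0 m2 (sOf M p.1) p.2 * Real.cos (∑ ν, sOf M p.1 ν * z ν)
      = ∑' k : Fin (d + 1) → ℤ, twoPtIntegrand m2 z (cornerPt (fun ν => 2 * Real.pi / (M ν : ℝ)) k) := by
    rw [← (aliasUnfoldEquiv M).tsum_eq]
    refine tsum_congr fun p => ?_
    obtain ⟨q, j⟩ := p
    rw [aliasTerm0_mul_cos_eq]
    show twoPtIntegrand m2 z (aliasPt (sOf M q) j) = twoPtIntegrand m2 z (cornerPt (fun ν => 2 * Real.pi / (M ν : ℝ)) (aliasUnfoldIdx M (q, j)))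
    rw [cornerPt_aliasUnfoldIdx]
  -- the volume factor `|Ω|⁻¹ = (2π)^{−n}·Π_ν 2π∕M_ν`
  have hcard : (Fintype.card (Tor M) : ℝ)⁻¹ = ((2 * Real.pi) ^ (d + 1))⁻¹ * ∏ ν, 2 * Real.pi / (M ν : ℝ) := by
    rw [Fintype.card_pi]
    push_cast
    simp only [ZMod.card]
    rw [Finset.prod_div_distrib, Finset.prod_const, Finset.card_univ, Fintype.card_fin, div_eq_mul_inv, ← mul_assoc, inv_mul_cancel₀ hπ, one_mul]
  rw [hker, hprod, hunf, hcard, mul_assoc, ← tsum_mul_left]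

end Unfolding

/-! ## §5 The thermodynamic limit -/

section Limit

variable {d : ℕ}

/-- **THE INFINITE-VOLUME CONTINUUM BLOCK-SMEARED TWO-POINT FUNCTION** `S₂^{ℝ}(z) = (2π)^{−n}∫_{ℝ^n} |u⁰(p)|² cos(p·z)∕(|p|² + m²) dp` (`z ∈ ℤ^n`).
[cite: King1986, Thm 2.1 (2.22) p.654, (4.5) p.670] -/
def kingS2Inf (m2 : ℝ) (z : Fin (d + 1) → ℤ) : ℝ := ((2 * Real.pi) ^ (d + 1))⁻¹ * ∫ p : Fin (d + 1) → ℝ, twoPtIntegrand m2 z p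

/-- ★★★ **THE THERMODYNAMIC LIMIT**: along ANY sequence of unit tori `Ω_k = Π_ν ℤ∕M_{k,ν}` with every period `M_{k,ν} → ∞` (and `M_{k,ν} ≥ 1`), for `m² > 0` and every separation
`z ∈ ℤ^n`: `S₂^{(∞)}_{Ω_k}(0, z mod M_k) → S₂^{ℝ}(z)`. [cite: King1986, Thm 2.1 (2.22)–(2.23) p.654 (finite volume, uniform constants); folklore (infinite volume of the free field)] -/
theorem tendsto_kingS2Lim_volume {m2 : ℝ} (hm : 0 < m2) (Mseq : ℕ → Fin (d + 1) → ℕ) (hpos : ∀ k ν, 0 < Mseq k ν)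
    (hlim : ∀ ν, Tendsto (fun k => (Mseq k ν : ℝ)) atTop atTop) (z : Fin (d + 1) → ℤ) :
    Tendsto (fun k => haveI : ∀ ν, NeZero (Mseq k ν) := fun ν => ⟨(hpos k ν).ne'⟩
      kingS2Lim (Mseq k) m2 0 (fun ν => ((z ν : ℤ) : ZMod (Mseq k ν)))) atTop (𝓝 (kingS2Inf m2 z)) := by
  have hπ := Real.pi_pos
  -- meshes `ℓ_{k,ν} = 2π∕M_{k,ν}`
  set ℓ : ℕ → Fin (d + 1) → ℝ := fun k ν => 2 * Real.pi / (Mseq k ν : ℝ) with hℓ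
  have hℓpos : ∀ k ν, 0 < ℓ k ν := fun k ν => by
    have : (0 : ℝ) < Mseq k ν := by exact_mod_cast hpos k ν
    simp only [hℓ]; positivity
  have hℓle : ∀ k ν, ℓ k ν ≤ 2 * Real.pi := fun k ν => by
    have h1 : (1 : ℝ) ≤ Mseq k ν := by exact_mod_cast hpos k ν
    simp only [hℓ]
    rw [div_le_iff₀ (by linarith)]
    nlinarith
  have hℓ0 : ∀ ν, Tendsto (fun k => ℓ k ν) atTop (𝓝 0) := fun ν => by
    simp only [hℓ]
    exact (tendsto_const_nhds (x := 2 * Real.pi)).div_atTop (hlim ν)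
  -- the engine
  have hC : (0 : ℝ) ≤ m2⁻¹ := by positivity
  have hE : Integrable fun t : ℝ => (17 + 16 * Real.pi ^ 2) * (1 + t ^ 2)⁻¹ := integrable_inv_one_add_sq.const_mul _
  have heng := tendsto_latticeSum_continuous (ι := Fin (d + 1)) (twoPtIntegrand m2 z) (continuous_twoPtIntegrand hm z) hC
    (e := fun s => Real.sinc (s / 2) ^ 2) (E := fun t => (17 + 16 * Real.pi ^ 2) * (1 + t ^ 2)⁻¹) (fun s => sq_nonneg _) (δ := 2 * Real.pi)
    (fun s t hst => sinc_sq_half_window hst) hE (abs_twoPtIntegrand_le hm z) ℓ hℓpos hℓle hℓ0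
  have hlim' := heng.const_mul (((2 * Real.pi) ^ (d + 1))⁻¹)
  refine hlim'.congr fun k => ?_
  haveI : ∀ ν, NeZero (Mseq k ν) := fun ν => ⟨(hpos k ν).ne'⟩
  rw [kingS2Lim_eq_latticeSum (Mseq k) hm z]

/-- ★★ `|S₂^{ℝ}(z)| ≤ m⁻²` (the volume-free bound of part Ϝ-d passes to the limit, along the cubic tori `(ℤ∕(k+1))^{d+1}`). [cite: King1986, Thm 2.1 (2.23) p.654, (4.8) p.671] -/
theorem abs_kingS2Inf_le {m2 : ℝ} (hm : 0 < m2) (z : Fin (d + 1) → ℤ) : |kingS2Inf m2 z| ≤ m2⁻¹ := by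
  have hlim := tendsto_kingS2Lim_volume hm (fun k _ => k + 1) (fun k _ => Nat.succ_pos k)
    (fun ν => by
      have : Tendsto (fun k : ℕ => ((k : ℝ) + 1)) atTop atTop := tendsto_atTop_add_const_right _ 1 tendsto_natCast_atTop_atTop
      refine this.congr fun k => ?_
      push_cast; ring) z
  refine le_of_tendsto ((continuous_abs.tendsto _).comp hlim) (Filter.Eventually.of_forall fun k => ?_)
  haveI : ∀ ν : Fin (d + 1), NeZero ((fun (k : ℕ) (_ : Fin (d + 1)) => k + 1) k ν) := fun ν => ⟨Nat.succ_ne_zero k⟩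
  exact abs_kingS2Lim_le 3 (fun _ : Fin (d + 1) => k + 1) (by decide) (by norm_num) hm 0 _

/-! ## §6 The same for NE2's continuum unit kernel `C^{(∞)} = S₂^{(∞)} + a_∞⁻¹·1` -/

/-- For `|z| < M` the residue of `z` vanishes iff `z = 0`. [folklore] -/
theorem intCast_zmod_eq_zero_iff_of_abs_lt {Mn : ℕ} {z : ℤ} (h : |z| < Mn) : ((z : ZMod Mn) = 0 ↔ z = 0) := by
  rw [ZMod.intCast_zmod_eq_zero_iff_dvd]
  refine ⟨fun hd => ?_, by rintro rfl; simp⟩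
  by_contra hz
  linarith [Int.le_of_dvd (abs_pos.mpr hz) ((dvd_abs _ _).mpr hd)]

/-- Along tori with all periods `→ ∞`, eventually `z mod M_k = 0 ↔ z = 0`. [folklore] -/
theorem eventually_zmod_eq_zero_iff (Mseq : ℕ → Fin (d + 1) → ℕ) (hlim : ∀ ν, Tendsto (fun k => (Mseq k ν : ℝ)) atTop atTop) (z : Fin (d + 1) → ℤ) :
    ∀ᶠ k in atTop, ((fun ν => ((z ν : ℤ) : ZMod (Mseq k ν))) = 0 ↔ z = 0) := by
  have hev : ∀ ν, ∀ᶠ k in atTop, (|z ν| : ℝ) < Mseq k ν := fun ν => (hlim ν).eventually_gt_atTop _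
  filter_upwards [Filter.eventually_all.mpr hev] with k hk
  have hk' : ∀ ν, |z ν| < (Mseq k ν : ℤ) := fun ν => by exact_mod_cast hk ν
  refine ⟨fun h => funext fun ν => (intCast_zmod_eq_zero_iff_of_abs_lt (hk' ν)).mp (congr_fun h ν), ?_⟩
  rintro rfl; funext ν; simp

/-- ★★ **THE THERMODYNAMIC LIMIT OF NE2's CONTINUUM UNIT KERNEL**: `C^{(∞)}_{Ω_k}(0, z mod M_k) → S₂^{ℝ}(z) + a_∞⁻¹[z = 0]` along any tori with all periods `→ ∞`
(`a, m² > 0`; the block-spin white noise is a volume-independent diagonal). [cite: King1986, (2.14) p.653, Thm 2.1 (2.22) p.654] -/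
theorem tendsto_blockCovLim_volume (L : ℕ) {a m2 : ℝ} (hm : 0 < m2) (Mseq : ℕ → Fin (d + 1) → ℕ) (hpos : ∀ k ν, 0 < Mseq k ν)
    (hlim : ∀ ν, Tendsto (fun k => (Mseq k ν : ℝ)) atTop atTop) (z : Fin (d + 1) → ℤ) :
    Tendsto (fun k => haveI : ∀ ν, NeZero (Mseq k ν) := fun ν => ⟨(hpos k ν).ne'⟩
      blockCovLim L (Mseq k) a m2 0 (fun ν => ((z ν : ℤ) : ZMod (Mseq k ν)))) atTop
      (𝓝 (kingS2Inf m2 z + (aInf a L)⁻¹ * (if z = 0 then 1 else 0))) := by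
  have h1 := tendsto_kingS2Lim_volume hm Mseq hpos hlim z
  have h2 : Tendsto (fun k => haveI : ∀ ν, NeZero (Mseq k ν) := fun ν => ⟨(hpos k ν).ne'⟩
      (aInf a L)⁻¹ * (if (0 : Tor (Mseq k)) = (fun ν => ((z ν : ℤ) : ZMod (Mseq k ν))) then (1 : ℝ) else 0)) atTop
      (𝓝 ((aInf a L)⁻¹ * (if z = 0 then 1 else 0))) := by
    refine tendsto_const_nhds.congr' ?_
    filter_upwards [eventually_zmod_eq_zero_iff Mseq hlim z] with k hk
    haveI : ∀ ν, NeZero (Mseq k ν) := fun ν => ⟨(hpos k ν).ne'⟩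
    have hiff : ((0 : Tor (Mseq k)) = fun ν => ((z ν : ℤ) : ZMod (Mseq k ν))) ↔ z = 0 := by
      rw [eq_comm]; exact hk
    by_cases hz : z = 0
    · rw [if_pos hz, if_pos (hiff.mpr hz)]
    · rw [if_neg hz, if_neg (fun h => hz (hiff.mp h))]
  refine (h1.add h2).congr fun k => ?_
  haveI : ∀ ν, NeZero (Mseq k ν) := fun ν => ⟨(hpos k ν).ne'⟩
  rw [kingS2Lim_eq_blockCovLim_sub L (Mseq k) a m2]
  ring

end Limit

end Summit.QuantumFields.YangMills.BalabanUVNodes.N15KingModelRung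

end
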